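import Mathlib.MeasureTheory.Measure.Lebesgue.Basic
import HarnessLib

/-!
# Line `LayerChain` of the crux `StackingLiminf` (stmt-Ventures-19145): the homogenised stacking
# Wulff bodies `W_f` — DEFINITIONS (Step 2 / Step 3(a) vocabulary of the planner's line)

Route `StickyWulffConstant` of the venture `Summits/Ventures/Crystal3D` (cell `crystal3d-full`).
This file holds, VERBATIM from the planner's line skeleton `LayerChain.lean` v3 (cf-p1 gen 10, item
evidence on stmt-Ventures-19145, 2026-08-26T17:06Z), the finite-dimensional objects that two registered
stubs of that line are ABOUT, so that the stub proofs (separate `Theorems/` files) and the skeleton can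
name them:

* `dot3`, `aVec`, `bPlus`, `bMinus` — the hexagonal frame at bond length `1`: in-plane bonds `a_i`, upward
  bonds `(±ℓ_i, h)` across a `+1` / `-1` gap, `h = √(2/3)`;
* `stackPhi f n τ = Φ_f(n, τ)` — the lifted cell function (support function of the zonotope
  `Ẑ_f ⊂ ℝ⁴` at `(n, τ)`), `f` = density of `-1` gaps, `τ` = the scalar corrector slope;
* `stackTension f n = ⨅ τ, Φ_f(n, τ)` — the homogenised stacking surface tension;
* `stackWulff f = W_f = {v | ∀ n τ, v·n ≤ Φ_f(n, τ)}` and its horizontal sections `stackSlice f y`;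
* `calibFlux` — the flux of a bond flow through a plane of normal `n` (Step 3(a));
* the planner's PROVED weak duality `calibFlux_le_stackPhi` and its corollary
  `mem_stackWulff_of_certificate` (membership in `W_f` from a zonotope certificate).

The two registered stubs these objects serve are stated over them WITHOUT further `Prop` definitions:
SLICE DOMINATION `∀ f ∈ [0,1], ∀ y, volume (stackSlice 0 y) ≤ volume (stackSlice f y)` (stub 2) and the
discrete CALIBRATION `∀ f ∈ [0,1], ∀ n, ∃ α βp βm ∈ [−1,1]³, Σ βp = Σ βm ∧ stackTension f n ≤ calibFlux f n α βp βm`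
(stub 3); the banked companion `StackVolumeLaw` reads `volume (stackWulff f) = 4√2 (16 + f(1−f))`.

Numerical / exact status (not used here): `SliceDomination` and `StackVolumeLaw` certified TRUE as
typed by cf-p2 R19 (kit j257743 / j257744, exact arithmetic, 0 mismatches; `A_f − A_0 = 2f(1−f)e(Z) ≥ 0`).
WHAT THIS IS NOT: no theorem about the crux; the chain-side vocabulary of Step 1 stays def-free (landed
stub `stub_layerDecomposition`, p456192); rung F-C1 not moved.
-/

noncomputable section

namespace Summit.Ventures.Crystal3D.LayerChain

/-- Dot product on `Fin 3 → ℝ`, written out. -/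
def dot3 (u v : Fin 3 → ℝ) : ℝ := u 0 * v 0 + u 1 * v 1 + u 2 * v 2

/-- In-plane bond vectors `a₁, a₂, a₃` (one per pair `±`). -/
def aVec (i : Fin 3) : Fin 3 → ℝ :=
  ![![1, 0, 0], ![1 / 2, Real.sqrt 3 / 2, 0], ![-(1 / 2), Real.sqrt 3 / 2, 0]] i

/-- Upward bond vectors across a `+1` gap: `(ℓ_i, h)`, `ℓ₁ = (½, √3/6)`, `ℓ₂ = (−½, √3/6)`,
`ℓ₃ = (0, −√3/3)`, `h = √(2/3)`. -/
def bPlus (i : Fin 3) : Fin 3 → ℝ :=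
  ![![1 / 2, Real.sqrt 3 / 6, Real.sqrt (2 / 3)], ![-(1 / 2), Real.sqrt 3 / 6, Real.sqrt (2 / 3)],
    ![0, -(Real.sqrt 3 / 3), Real.sqrt (2 / 3)]] i

/-- Upward bond vectors across a `-1` gap: `(−ℓ_i, h)`. -/
def bMinus (i : Fin 3) : Fin 3 → ℝ :=
  ![![-(1 / 2), -(Real.sqrt 3 / 6), Real.sqrt (2 / 3)], ![1 / 2, -(Real.sqrt 3 / 6), Real.sqrt (2 / 3)],
    ![0, Real.sqrt 3 / 3, Real.sqrt (2 / 3)]] i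

/-- The lifted cell function `Φ_f(n, τ)` (`f` = density of `-1` gaps, `τ` = the scalar corrector slope):
support function, at `(n, τ)`, of the zonotope `Ẑ_f ⊂ ℝ⁴` generated by `±(a_i, 0)`,
`±((1-f) b⁺_i, (1-f) f)`, `±(f b⁻_i, -(1-f) f)`. -/
def stackPhi (f : ℝ) (n : Fin 3 → ℝ) (τ : ℝ) : ℝ :=
  (∑ i : Fin 3, |dot3 n (aVec i)|) + (∑ i : Fin 3, |(1 - f) * dot3 n (bPlus i) + (1 - f) * f * τ|) +
    ∑ i : Fin 3, |f * dot3 n (bMinus i) - (1 - f) * f * τ|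

/-- The homogenised stacking surface tension `φ_f(n) = inf_τ Φ_f(n, τ)` (bonds broken per area
`1/√2`·this). -/
def stackTension (f : ℝ) (n : Fin 3 → ℝ) : ℝ := ⨅ τ : ℝ, stackPhi f n τ

/-- The homogenised stacking Wulff body `W_f = {v | ∀ n τ, v·n ≤ Φ_f(n, τ)}` = `Ẑ_f ∩ {x₄ = 0}`;
`W_0` is the truncated octahedron (fcc), `W_1` its basal mirror image, `W_{1/2}` CKL's hcp body. -/
def stackWulff (f : ℝ) : Set (Fin 3 → ℝ) :=
  {v | ∀ n : Fin 3 → ℝ, ∀ τ : ℝ, dot3 v n ≤ stackPhi f n τ}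

/-- Horizontal section of `W_f` at height `y`, as a subset of `ℝ × ℝ`. -/
def stackSlice (f y : ℝ) : Set (ℝ × ℝ) := {p | (![p.1, p.2, y] : Fin 3 → ℝ) ∈ stackWulff f}

/-- The flux of a bond flow with in-layer values `α`, `+`-gap values `βp`, `−`-gap values `βm` through
a plane of normal `n` crossing gaps with `−`-fraction `f` (per site, bond-length units). -/
def calibFlux (f : ℝ) (n α βp βm : Fin 3 → ℝ) : ℝ :=
  (∑ i : Fin 3, α i * dot3 n (aVec i)) + (1 - f) * (∑ i : Fin 3, βp i * dot3 n (bPlus i)) +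
    f * (∑ i : Fin 3, βm i * dot3 n (bMinus i))

/-- Weak duality (planner, proved): any admissible flow's flux is at most every `Φ_f(n,τ)`; so the
calibration stub asserts attainment, not an inequality that could hold vacuously. -/
theorem calibFlux_le_stackPhi (f : ℝ) (n α βp βm : Fin 3 → ℝ)
    (hα : ∀ i, |α i| ≤ 1) (hp : ∀ i, |βp i| ≤ 1) (hm : ∀ i, |βm i| ≤ 1)
    (hsum : (∑ i : Fin 3, βp i) = (∑ i : Fin 3, βm i)) (τ : ℝ) :
    calibFlux f n α βp βm ≤ stackPhi f n τ := by
  unfold calibFlux stackPhi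
  simp only [Fin.sum_univ_three] at hsum ⊢
  have h1 : ∀ i, α i * dot3 n (aVec i) ≤ |dot3 n (aVec i)| := fun i => by
    have := hα i
    calc α i * dot3 n (aVec i) ≤ |α i * dot3 n (aVec i)| := le_abs_self _
      _ = |α i| * |dot3 n (aVec i)| := abs_mul _ _
      _ ≤ 1 * |dot3 n (aVec i)| := by gcongr
      _ = _ := one_mul _
  have h2 : ∀ i, βp i * ((1 - f) * dot3 n (bPlus i) + (1 - f) * f * τ) ≤
      |(1 - f) * dot3 n (bPlus i) + (1 - f) * f * τ| := fun i => by
    have := hp i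
    calc βp i * ((1 - f) * dot3 n (bPlus i) + (1 - f) * f * τ)
        ≤ |βp i * ((1 - f) * dot3 n (bPlus i) + (1 - f) * f * τ)| := le_abs_self _
      _ = |βp i| * |(1 - f) * dot3 n (bPlus i) + (1 - f) * f * τ| := abs_mul _ _
      _ ≤ 1 * |(1 - f) * dot3 n (bPlus i) + (1 - f) * f * τ| := by gcongr
      _ = _ := one_mul _
  have h3 : ∀ i, βm i * (f * dot3 n (bMinus i) - (1 - f) * f * τ) ≤
      |f * dot3 n (bMinus i) - (1 - f) * f * τ| := fun i => by
    have := hm i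
    calc βm i * (f * dot3 n (bMinus i) - (1 - f) * f * τ)
        ≤ |βm i * (f * dot3 n (bMinus i) - (1 - f) * f * τ)| := le_abs_self _
      _ = |βm i| * |f * dot3 n (bMinus i) - (1 - f) * f * τ| := abs_mul _ _
      _ ≤ 1 * |f * dot3 n (bMinus i) - (1 - f) * f * τ| := by gcongr
      _ = _ := one_mul _
  have ha0 := h1 0; have ha1 := h1 1; have ha2 := h1 2
  have hb0 := h2 0; have hb1 := h2 1; have hb2 := h2 2
  have hc0 := h3 0; have hc1 := h3 1; have hc2 := h3 2
  have key : (1 - f) * (βp 0 * dot3 n (bPlus 0) + βp 1 * dot3 n (bPlus 1) + βp 2 * dot3 n (bPlus 2)) +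
      f * (βm 0 * dot3 n (bMinus 0) + βm 1 * dot3 n (bMinus 1) + βm 2 * dot3 n (bMinus 2)) =
      (βp 0 * ((1 - f) * dot3 n (bPlus 0) + (1 - f) * f * τ) +
        βp 1 * ((1 - f) * dot3 n (bPlus 1) + (1 - f) * f * τ) +
        βp 2 * ((1 - f) * dot3 n (bPlus 2) + (1 - f) * f * τ)) +
      (βm 0 * (f * dot3 n (bMinus 0) - (1 - f) * f * τ) +
        βm 1 * (f * dot3 n (bMinus 1) - (1 - f) * f * τ) +
        βm 2 * (f * dot3 n (bMinus 2) - (1 - f) * f * τ)) := by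
    have : (1 - f) * f * τ * (βp 0 + βp 1 + βp 2) = (1 - f) * f * τ * (βm 0 + βm 1 + βm 2) := by
      rw [hsum]
    linear_combination -this
  linarith [key]

/-- Membership in `W_f` from a ZONOTOPE CERTIFICATE (the weak-duality direction of `W_f = Ẑ_f ∩ {x₄ = 0}`):
a vector whose pairing with every normal `n` is the flux of an admissible conserved flow
(coefficients `s, t, u ∈ [−1, 1]³` on the `a`, `(1−f) b⁺`, `f b⁻` bonds with `Σ t = Σ u`) lies in `W_f`. -/
theorem mem_stackWulff_of_certificate (f : ℝ) (v s t u : Fin 3 → ℝ)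
    (hs : ∀ i, |s i| ≤ 1) (ht : ∀ i, |t i| ≤ 1) (hu : ∀ i, |u i| ≤ 1)
    (hsum : (∑ i : Fin 3, t i) = (∑ i : Fin 3, u i))
    (hv : ∀ n : Fin 3 → ℝ, dot3 v n = calibFlux f n s t u) :
    v ∈ stackWulff f := by
  intro n τ
  rw [hv n]
  exact calibFlux_le_stackPhi f n s t u hs ht hu hsum τ

end Summit.Ventures.Crystal3D.LayerChain
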